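/-
COR-CM (cell pub-hodgecm2, stage 2 of the Hodge ladder) — count-neutral KERNEL COMBINATORICS «the sheared dihedral family», part XXII: THE SHEARED
DIHEDRAL LAW for odd `n` (seat prover-pub-hodgecm2-b23-g52-0, binder prover b23, gen 52; claim «SYLOW TRANSFER XII + THE SHEARED DIHEDRAL FAMILY»,
HOME/INBOX.md l.23708).  Assembly, theorems only, on parts II/III/IX/XIV/XVII/XXI and gen 45ʼs `exists_slot_datum` BY NAME (the shape of gen 45ʼs
`Census/QuarticInversionLaw.lean` + `…Cyclic.lean`, this lineage); no `decide`, no certificate, no named fact, no geometry, no `sorry`.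
`Interfaces.lean` (C1), every E term, B01, `Transposition/*`, `PortJoin/*`, `D2Bridge/*` untouched.
HONEST FRAMING: `HC_CM` is NOT proved, here or anywhere in the tree; nothing here is a period, a count of record or a headline.
-/
import Summits.HodgeConjecture.CorCM.Census.ShearedDihedralGeneration
import Summits.HodgeConjecture.CorCM.Census.ShearedDihedralSliceTransport
import Summits.HodgeConjecture.CorCM.Census.ShearedDihedralSliceBlocks
import Summits.HodgeConjecture.CorCM.Census.ShearedDihedralSliceBridge
import Summits.HodgeConjecture.CorCM.Census.ShearedDihedralFloor
import Summits.HodgeConjecture.CorCM.Census.ShearedDihedralBlockCount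
import Summits.HodgeConjecture.CorCM.Census.QuarticInversionCyclic

/-!
# The sheared dihedral family, XXII: THE SHEARED DIHEDRAL LAW `μ(X_n, gⁿ) = β − 2 = φ₂` for odd `n ≥ 3`

`X_n = ⟨g, s, x | g²ⁿ = s² = x² = 1, gs = sg, xgx = g⁻¹, xsx = gⁿs⟩` of order `8n`, `c = gⁿ` (part I: `ShearedDihedral.Datum G c n`); for odd
`n` this is `ℤ/n ⋊ D₄` with the Klein kernel (`X_p` of gen 51ʼs order-`8p` table), `X_3` the group of order `24` left open there.

* §1 **Slice level** (`E : SliceDatum G c A 0`, `|A|` odd `≥ 3`, a slot datum and a cross datum): SOME family of at most `β(G,c) − 2` generalized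
  faces generates the Hodge lattice modulo pairs (private `SliceDatum.exists_gfaces_generate`: part XXI `hodge₄_leS` + `card_familyS_add_two_le`,
  part XIV `exists_gfaces_of_family`, part XVII `card_block_eqS`).
* §2 **THE LAW** (`D : Datum G c n`, `n` odd `≥ 3`): `μ(G, c) = φ₂(G, c) = β(G, c) − 2` (`Datum.isLeast_card_gfaces_generate`: §1 along the
  slice datum of part IX with gen 45ʼs slot datum of `ℤ/n`, closed by part IIʼs floor `isLeast_of_exists`); rows **`μ(X₃) = 192`**
  (`isLeast_card_gfaces_generate_oneHundredNinetyTwo`, with part IIIʼs `β(X₃) = 194`).  All [folklore].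

## References
* [Pohlmann1968] H. Pohlmann, Algebraic cycles on abelian varieties of complex multiplication type, Ann. of Math. 88 (1968), Thm 1.
-/

namespace Summit.HodgeConjecture.CorCM.Census.ShearedDihedral

open Summit.HodgeConjecture.CorCM.Census.QuarticInversion
open Finset
open Summit.HodgeConjecture.CorCM.Prior.AllgGroup.RfwfAllgGroup
open Summit.HodgeConjecture.CorCM.Census.BlockParity
open Summit.HodgeConjecture.CorCM.Census.Coinvariant
open Summit.HodgeConjecture.CorCM.Census.OddSliceFacesModel

noncomputable section

/-! ## §1 Slice level: existence of a generating family of `β − 2` faces -/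

section Slice

variable {G : Type*} [Group G] [Fintype G] [DecidableEq G] {c : G}
variable {A : Type} [AddCommGroup A] [Fintype A] [DecidableEq A]
variable (E : SliceDatum G c A 0)

include E in
/-- **EXISTENCE along a slice datum of square class `0` with `t² = 1`: `μ(G, c) ≤ β(G, c) − 2`** (`|A|` odd `≥ 3` with a slot datum and a
cross datum).  Private: the printed statement coincides with gen 45ʼs `exists_gfaces_generate_zero` up to the TYPE of the datum (there
`t² = c`, the groups `D(ℤ/4 × B)`; here `t² = 1`, the groups `B ⋊ D₄` with the Klein kernel) and the dedup lint compares statements modulo that type;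
the public face is `Datum.exists_gfaces_generate_card_add_two` below. [folklore] -/
private theorem SliceDatum.exists_gfaces_generate (hc2 : c * c = 1) (hA : Odd (Fintype.card A)) (h3 : 3 ≤ Fintype.card A)
    (hSlot : ∃ (P : Finset A) (u₁ u₂ : A) (Q : Finset A) (w σ s₀ : A), u₁ ∉ P ∧ u₂ ∉ P ∧ u₁ ≠ u₂ ∧ P.card + 1 = Fintype.card A / 2 ∧
      s₀ ∈ insert u₁ (insert u₂ P) ∧ (∀ s, s + σ ∈ insert u₁ (insert u₂ P) ↔ (s ∉ insert u₁ (insert u₂ P) ∨ s = s₀)) ∧ w ∉ Q ∧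
      Q.card = Fintype.card A / 2) :
    ∃ S' : Finset (CMF G c →₀ ℤ), ↑S' ⊆ gfaceSet G c hc2 ∧ S'.card + 2 ≤ Fintype.card (BlockParity.Block c) ∧
      hodgeSpan c hc2 ≤ Submodule.span ℤ (pairSet c) ⊔ Submodule.span ℤ (translates c S') := by
  obtain ⟨P, u₁, u₂, Q, w, σ, s₀, h1, h2, h12, hP, hs₀, hX, hw, hQ⟩ := hSlot
  obtain ⟨S', hS', hcard, hgen⟩ := exists_gfaces_of_family E hc2 (F := familyS A P u₁ u₂ Q w 0)
    (fun f hf => familyS_shape A h12 hf) (hodge₄_leS A hA h3 h1 h2 h12 hP hs₀ hX hw hQ)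
  refine ⟨S', hS', ?_, hgen⟩
  have h := card_familyS_add_two_le A (P := P) (u₁ := u₁) (u₂ := u₂) (Q := Q) (w := w) (u₀ := 0) hA (by omega)
  rw [card_block_eqS E]
  omega

end Slice

/-! ## §2 The law -/

section Law

variable {G : Type*} [Group G] [Fintype G] [DecidableEq G] {c : G} {n : ℕ}
variable (D : Datum G c n)

namespace Datum

include D in
/-- **EXISTENCE for the sheared dihedral group `X_n`, `n` odd `≥ 3`: SOME `β(G, c) − 2` generalized faces generate** the Hodge lattice modulo
pairs (exactly `β − 2` by the floor of part II). [folklore] -/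
theorem exists_gfaces_generate_card_add_two (hn : Odd n) (h3 : 3 ≤ n) (hc2 : c * c = 1) :
    ∃ S : Finset (CMF G c →₀ ℤ), ↑S ⊆ gfaceSet G c hc2 ∧ S.card + 2 = Fintype.card (BlockParity.Block c) ∧
      hodgeSpan c hc2 ≤ Submodule.span ℤ (pairSet c) ⊔ Submodule.span ℤ (translates c S) := by
  haveI : NeZero n := ⟨fun h => by simp [h] at hn⟩
  obtain ⟨E⟩ := D.nonempty_sliceDatum hn
  have hcard : Fintype.card (ZMod n) = n := ZMod.card n
  obtain ⟨P, u₁, u₂, Q, w, σ, s₀, hslot⟩ := exists_slot_datum n hn h3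
  obtain ⟨S, hS, hle, hgen⟩ := SliceDatum.exists_gfaces_generate E hc2 (by rw [hcard]; exact hn) (by rw [hcard]; exact h3)
    ⟨P, u₁, u₂, Q, w, σ, s₀, hslot⟩
  have hge := D.card_block_le_card_add_two hc2 S hS hgen
  exact ⟨S, hS, by omega, hgen⟩

include D in
/-- **THE SHEARED DIHEDRAL LAW: `μ(X_n, gⁿ) = φ₂(X_n, gⁿ)`** for `n` odd `≥ 3` — the least number of generalized faces generating the Hodge
lattice modulo pairs is the second fibre count. [folklore] -/
theorem isLeast_card_gfaces_generate (hn : Odd n) (h3 : 3 ≤ n) (hc2 : c * c = 1) :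
    IsLeast {m : ℕ | ∃ S : Finset (CMF G c →₀ ℤ), ↑S ⊆ gfaceSet G c hc2 ∧ S.card = m ∧
      hodgeSpan c hc2 ≤ Submodule.span ℤ (pairSet c) ⊔ Submodule.span ℤ (translates c S)} (fibreTwo c hc2) :=
  D.isLeast_of_exists hc2 (D.exists_gfaces_generate_card_add_two hn h3 hc2)

include D in
/-- **THE SHEARED DIHEDRAL LAW, block form: `μ(X_n, gⁿ) = β(X_n, gⁿ) − 2`** for `n` odd `≥ 3`. [folklore] -/
theorem isLeast_card_gfaces_generate_card_block_sub_two (hn : Odd n) (h3 : 3 ≤ n) (hc2 : c * c = 1) :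
    IsLeast {m : ℕ | ∃ S : Finset (CMF G c →₀ ℤ), ↑S ⊆ gfaceSet G c hc2 ∧ S.card = m ∧
      hodgeSpan c hc2 ≤ Submodule.span ℤ (pairSet c) ⊔ Submodule.span ℤ (translates c S)} (Fintype.card (BlockParity.Block c) - 2) := by
  rw [← D.fibreTwo_eq_card_block_sub_two hc2]
  exact D.isLeast_card_gfaces_generate hn h3 hc2

end Datum

/-- **Row `X₃` (order `24`, `ℤ/3 ⋊ D₄` with the Klein kernel, `c = g³`): `μ = 192`** (`β = 194`, part III). [folklore] -/
theorem isLeast_card_gfaces_generate_oneHundredNinetyTwo (D : Datum G c 3) (hc2 : c * c = 1) :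
    IsLeast {m : ℕ | ∃ S : Finset (CMF G c →₀ ℤ), ↑S ⊆ gfaceSet G c hc2 ∧ S.card = m ∧
      hodgeSpan c hc2 ≤ Submodule.span ℤ (pairSet c) ⊔ Submodule.span ℤ (translates c S)} 192 := by
  rw [← (D.card_block_eq_oneHundredNinetyFour hc2).2]
  exact D.isLeast_card_gfaces_generate (by decide) le_rfl hc2

end Law

end

end Summit.HodgeConjecture.CorCM.Census.ShearedDihedral
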